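import Summits.Ventures.PercRepro.RankLevelSetRuleQMomentRec

/-!
# PercRepro — THE CORNER `#P = q − k + 1` OF EVERY FAMILY `k` FOR `q ≥ 4k⁴`, UNIFORMLY IN `k` (p4, gen 28; C-044; paper
proofs/P4-CELL-THREE.md §13.11.7)

At the corner `m = q + 1 − k` (`u = k − 1`, `n = 2k − 1`) the first column of `R̂ = Σ_{0<i<k} C(2k−1,i)·W_i(q,m)` already pays
`Φ(q+k,q)` once `q ≥ 4k⁴`: `(2k−1)·W_1` with `(2q−k+2)·W_1 = q − (k−2)·S(q,m)` (the anchor of the master sum, from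
`sumS_succ`), `S(q,m) ≤ S(q,q−1)` (monotone in `m`) and **`S(q,q−1)² ≤ q`** (`diag_sq_le`: the diagonal `S(q+1,q)` obeys the
Wallis recurrence `S(q+2,q+1) = 2(q+2)/(2q+3)·S(q+1,q)` — from the `q`-shift `sumW_qsucc` and the anchors — so
`S(q+1,q)² ≤ q + 1` by induction), against `Φ(q+k,q) ≤ (k−1)·((q+k)/(q+1))^{k−1} ≤ (k−1)(q+1)/(q+1−(k−1)²)`
(`phiK_le_of_sq_lt`: `C(q+k,J)/C(q+J,J) ≤ ((q+k)/(q+1))^J` and the Bernoulli bound `(1+y)^n·(1−ny) ≤ 1`).  The remaining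
inequality is two polynomials with non-negative coefficients in `(q − 4k⁴, k − 3)` (`largeQ_certA`, `largeQ_certB`).
**`rhat_corner_of_large_q (q k) (hk : 3 ≤ k) (hq : 4·k⁴ ≤ q) : phiK (q+k) q ≤ rhat q k (q + 1 − k)`.**  With
RankLevelSetRuleQCornerReduction this gives the whole untruncated regime of every family `k ≥ 3` for every `q ≥ 4k⁴`.
Axioms standard.
-/

set_option maxHeartbeats 4000000

namespace PercRepro

open Finset

/-- The `q`-shift of the tilted moments: `W_j(q+1,m) = (q+1)/q · (W_j(q,m) − W_{j+1}(q,m))` (per term). -/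
lemma sumW_qsucc (q m j : ℕ) (hq : 0 < q) :
    sumW (q + 1) m j = ((q : ℚ) + 1) / q * (sumW q m j - sumW q m (j + 1)) := by
  unfold sumW
  rw [← Finset.sum_sub_distrib, Finset.mul_sum]
  refine Finset.sum_congr rfl (fun a _ => ?_)
  have hA : (0 : ℚ) < ((q + (j + a)).choose (j + a) : ℚ) := by exact_mod_cast Nat.choose_pos (by omega)
  have hB : ((q + (j + a) + 1).choose (j + a + 1) : ℚ)
      = ((q : ℚ) + (j + a) + 1) * ((q + (j + a)).choose (j + a) : ℚ) / ((j : ℚ) + a + 1) := by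
    have h := Nat.add_one_mul_choose_eq (q + (j + a)) (j + a)
    rw [eq_div_iff (by positivity)]
    exact_mod_cast h.symm
  have hC : ((q + (j + a) + 1).choose (j + a) : ℚ)
      = ((q + (j + a) + 1).choose (j + a + 1) : ℚ) * ((j : ℚ) + a + 1) / ((q : ℚ) + 1) := by
    have h := Nat.choose_succ_right_eq (q + (j + a) + 1) (j + a)
    rw [eq_div_iff (by positivity)]
    have h' : ((q + (j + a) + 1).choose (j + a + 1) : ℚ) * ((j : ℚ) + a + 1)
        = ((q + (j + a) + 1).choose (j + a) : ℚ) * (((q + (j + a) + 1 - (j + a) : ℕ) : ℚ)) := by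
      exact_mod_cast h
    rw [h', show q + (j + a) + 1 - (j + a) = q + 1 by omega]
    push_cast
    ring
  rw [show q + 1 + (j + a) = q + (j + a) + 1 by omega, show q + (j + 1 + a) = q + (j + a) + 1 by omega,
    show j + 1 + a = j + a + 1 by omega, hC, hB]
  have hq' : (q : ℚ) ≠ 0 := by exact_mod_cast hq.ne'
  field_simp
  ring

/-- The anchor of the master sum: `(q+m+1)·W_1(q,m) = q − (q−m−1)·S(q,m)` (from `sumS_succ`). -/
lemma sumW_one_anchor (q m : ℕ) :
    ((q : ℚ) + m + 1) * sumW q m 1 = q - ((q : ℚ) - m - 1) * sumS q m := by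
  have h1 := sumS_succ q m
  have h2 : sumS q (m + 1) = sumS q m + sumW q m 1 := by
    rw [sumW_succ, sumW_zero, sumW_zero]; ring
  rw [h2] at h1
  linear_combination h1

/-- `S(q,0) = 1`. -/
lemma sumS_zero_right (q : ℕ) : sumS q 0 = 1 := by
  unfold sumS; simp

/-- The diagonal `S(q+1,q)` obeys the Wallis recurrence `S(q+2,q+1) = 2(q+2)/(2q+3) · S(q+1,q)`. -/
lemma sumS_diag_succ (q : ℕ) :
    sumS (q + 2) (q + 1) = 2 * ((q : ℚ) + 2) / (2 * q + 3) * sumS (q + 1) q := by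
  have hsh := sumW_qsucc (q + 1) (q + 1) 0 (by omega)
  rw [show q + 1 + 1 = q + 2 by omega, sumW_zero, sumW_zero] at hsh
  have ha1 := sumW_one_anchor (q + 1) (q + 1)
  have ha0 := sumW_one_anchor (q + 1) q
  have hS : sumS (q + 1) (q + 1) = sumS (q + 1) q + sumW (q + 1) q 1 := by
    have := sumW_succ (q + 1) q 0
    rw [sumW_zero, sumW_zero] at this; linarith
  push_cast at hsh ha1 ha0
  have hq1 : ((q : ℚ) + 1 + 1 + 1) ≠ 0 := by positivity
  have hW0 : sumW (q + 1) q 1 = 1 / 2 := by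
    have h := ha0
    have hpos : (2 * (q : ℚ) + 2) ≠ 0 := by positivity
    refine mul_left_cancel₀ hpos ?_
    linear_combination h
  have hW1 : sumW (q + 1) (q + 1) 1 = ((q : ℚ) + 1 + sumS (q + 1) (q + 1)) / (2 * q + 3) := by
    have hpos : (2 * (q : ℚ) + 3) ≠ 0 := by positivity
    field_simp
    linear_combination ha1
  rw [hsh, hW1, hS, hW0]
  have hpos2 : (2 * (q : ℚ) + 3) ≠ 0 := by positivity
  have hpos3 : ((q : ℚ) + 1) ≠ 0 := by positivity
  field_simp
  ring

/-- `S(q+1,q)² ≤ q + 1` (induction on the Wallis recurrence). -/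
lemma sumS_diag_sq_le (q : ℕ) : (sumS (q + 1) q) ^ 2 ≤ (q : ℚ) + 1 := by
  induction q with
  | zero => rw [sumS_zero_right]; norm_num
  | succ n ih =>
    rw [show n + 1 + 1 = n + 2 by omega, sumS_diag_succ n]
    have hpos : (0 : ℚ) < 2 * n + 3 := by positivity
    have key : (2 * ((n : ℚ) + 2) / (2 * n + 3) * sumS (n + 1) n) ^ 2
        = (2 * ((n : ℚ) + 2) / (2 * n + 3)) ^ 2 * (sumS (n + 1) n) ^ 2 := by ring
    rw [key]
    have h2 : (2 * ((n : ℚ) + 2) / (2 * n + 3)) ^ 2 * (sumS (n + 1) n) ^ 2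
        ≤ (2 * ((n : ℚ) + 2) / (2 * n + 3)) ^ 2 * ((n : ℚ) + 1) := by
      apply mul_le_mul_of_nonneg_left ih; positivity
    refine le_trans h2 ?_
    rw [div_pow, div_mul_eq_mul_div, div_le_iff₀ (by positivity)]
    push_cast
    nlinarith [sq_nonneg ((n : ℚ) + 1)]

/-- `S(q,m)` is non-decreasing in `m`. -/
lemma sumS_mono_right (q m m' : ℕ) (h : m ≤ m') : sumS q m ≤ sumS q m' := by
  induction m' with
  | zero => rw [Nat.le_zero.mp h]
  | succ n ih =>
    rcases Nat.le_succ_iff.mp h with h' | h'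
    · have := ih h'
      have hstep : sumS q (n + 1) = sumS q n + sumW q n 1 := by
        have := sumW_succ q n 0; rw [sumW_zero, sumW_zero] at this; linarith
      have := sumW_pos q n 1
      linarith
    · rw [h']

/-- `0 < S(q,m)`. -/
lemma sumS_pos (q m : ℕ) : 0 < sumS q m := by
  rw [← sumW_zero]; exact sumW_pos q m 0

/-- At the corner `m = q + 1 − k` (`2 ≤ k ≤ q + 1`): `S(q,m)² ≤ q`. -/
lemma sumS_corner_sq_le (q k : ℕ) (hk : 2 ≤ k) (hkq : k ≤ q + 1) : (sumS q (q + 1 - k)) ^ 2 ≤ (q : ℚ) := by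
  obtain ⟨p, rfl⟩ : ∃ p, q = p + 1 := ⟨q - 1, by omega⟩
  have h1 : sumS (p + 1) (p + 1 + 1 - k) ≤ sumS (p + 1) p := sumS_mono_right _ _ _ (by omega)
  have h2 := sumS_diag_sq_le p
  have h0 : 0 < sumS (p + 1) (p + 1 + 1 - k) := sumS_pos _ _
  push_cast
  calc (sumS (p + 1) (p + 1 + 1 - k)) ^ 2 ≤ (sumS (p + 1) p) ^ 2 := by
        apply pow_le_pow_left₀ h0.le h1
    _ ≤ (p : ℚ) + 1 := h2

/-- Bernoulli's bound in reverse: `(1+y)^n · (1 − n·y) ≤ 1` for `y ≥ 0`. -/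
lemma one_add_pow_mul_le_one (y : ℚ) (hy : 0 ≤ y) : ∀ n : ℕ, (1 + y) ^ n * (1 - n * y) ≤ 1 := by
  intro n
  induction n with
  | zero => simp
  | succ n ih =>
    have h1 : (0 : ℚ) ≤ (1 + y) ^ n := by positivity
    calc (1 + y) ^ (n + 1) * (1 - ((n + 1 : ℕ) : ℚ) * y)
        = (1 + y) ^ n * (1 - n * y) - (1 + y) ^ n * ((n : ℚ) + 1) * y ^ 2 := by push_cast; ring
      _ ≤ (1 + y) ^ n * (1 - n * y) := by nlinarith [mul_nonneg h1 (sq_nonneg y), (Nat.cast_nonneg n : (0 : ℚ) ≤ n)]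
      _ ≤ 1 := ih

/-- `C(q+k, J)/C(q+J, J) ≤ ((q+k)/(q+1))^J`. -/
lemma choose_ratio_le_pow (q k J : ℕ) :
    ((q + k).choose J : ℚ) / ((q + J).choose J : ℚ) ≤ (((q : ℚ) + k) / (q + 1)) ^ J := by
  have hup : ((q + k).choose J : ℚ) ≤ (((q + k : ℕ) : ℚ) ^ J) / (Nat.factorial J : ℚ) := Nat.choose_le_pow_div J (q + k)
  have hlo : (((q + J + 1 - J : ℕ) ^ J : ℕ) : ℚ) / (Nat.factorial J : ℚ) ≤ ((q + J).choose J : ℚ) := by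
    have := Nat.pow_le_choose (α := ℚ) J (q + J)
    exact_mod_cast this
  rw [show q + J + 1 - J = q + 1 by omega] at hlo
  push_cast at hup hlo
  have hJ : (0 : ℚ) < (Nat.factorial J : ℚ) := by exact_mod_cast Nat.factorial_pos J
  have hden : (0 : ℚ) < ((q + J).choose J : ℚ) := by exact_mod_cast Nat.choose_pos (by omega)
  have hq1 : (0 : ℚ) < (q : ℚ) + 1 := by positivity
  rw [div_le_iff₀ hden, div_pow]
  calc ((q + k).choose J : ℚ) ≤ ((q : ℚ) + k) ^ J / (Nat.factorial J : ℚ) := hup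
    _ = ((q : ℚ) + k) ^ J / ((q : ℚ) + 1) ^ J * (((q : ℚ) + 1) ^ J / (Nat.factorial J : ℚ)) := by
        field_simp
    _ ≤ ((q : ℚ) + k) ^ J / ((q : ℚ) + 1) ^ J * ((q + J).choose J : ℚ) := by
        apply mul_le_mul_of_nonneg_left hlo; positivity

/-- `Φ(q+k, q) ≤ (k−1)·(q+1)/(q+1−(k−1)²)` for `1 ≤ k` and `(k−1)² < q+1`. -/
lemma phiK_le_of_sq_lt (q k : ℕ) (hk : 1 ≤ k) (hq : ((k : ℚ) - 1) ^ 2 < (q : ℚ) + 1) :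
    phiK (q + k) q ≤ ((k : ℚ) - 1) * ((q : ℚ) + 1) / ((q : ℚ) + 1 - ((k : ℚ) - 1) ^ 2) := by
  rw [phiK_eq_sum_Ioo q k hk]
  set x : ℚ := ((q : ℚ) + k) / (q + 1) with hx
  have hx1 : 1 ≤ x := by
    rw [hx, le_div_iff₀ (by positivity)]
    have : (1 : ℚ) ≤ k := by exact_mod_cast hk
    linarith
  -- each term is at most x^J ≤ x^(k-1)
  have hterm : ∀ J ∈ Ioo 0 k, ((q + k).choose J : ℚ) * (1 / ((q + J).choose J : ℚ)) ≤ x ^ (k - 1) := by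
    intro J hJ
    rw [Finset.mem_Ioo] at hJ
    rw [mul_one_div]
    calc ((q + k).choose J : ℚ) / ((q + J).choose J : ℚ) ≤ x ^ J := choose_ratio_le_pow q k J
      _ ≤ x ^ (k - 1) := pow_le_pow_right₀ hx1 (by omega)
  have hsum : ∑ J ∈ Ioo 0 k, ((q + k).choose J : ℚ) * (1 / ((q + J).choose J : ℚ)) ≤ ∑ J ∈ Ioo 0 k, x ^ (k - 1) :=
    Finset.sum_le_sum hterm
  rw [Finset.sum_const, Nat.card_Ioo, nsmul_eq_mul] at hsum
  -- x^(k-1) ≤ 1/(1 − (k−1)y), y = (k−1)/(q+1)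
  set y : ℚ := ((k : ℚ) - 1) / (q + 1) with hy
  have hy0 : 0 ≤ y := by rw [hy]; apply div_nonneg <;> [linarith [(show (1 : ℚ) ≤ k by exact_mod_cast hk)]; positivity]
  have hxy : x = 1 + y := by rw [hx, hy]; field_simp; ring
  have hB := one_add_pow_mul_le_one y hy0 (k - 1)
  have hk1 : ((k - 1 : ℕ) : ℚ) = (k : ℚ) - 1 := by push_cast [Nat.cast_sub hk]; ring
  rw [hk1] at hB
  have hpos : 0 < 1 - ((k : ℚ) - 1) * y := by
    rw [hy]
    have : ((k : ℚ) - 1) * (((k : ℚ) - 1) / (q + 1)) = ((k : ℚ) - 1) ^ 2 / (q + 1) := by ring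
    rw [this, sub_pos, div_lt_one (by positivity)]
    exact hq
  have hxk : x ^ (k - 1) ≤ 1 / (1 - ((k : ℚ) - 1) * y) := by
    rw [hxy, le_div_iff₀ hpos]
    exact hB
  have hk1' : ((k - 1 : ℕ) : ℚ) * x ^ (k - 1) ≤ ((k : ℚ) - 1) * (1 / (1 - ((k : ℚ) - 1) * y)) := by
    rw [hk1]
    apply mul_le_mul_of_nonneg_left hxk
    linarith [(show (1 : ℚ) ≤ k by exact_mod_cast hk)]
  refine le_trans hsum (le_trans hk1' (le_of_eq ?_))
  rw [hy]
  have hq1 : ((q : ℚ) + 1) ≠ 0 := by positivity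
  have hQ : ((q : ℚ) + 1 - ((k : ℚ) - 1) ^ 2) ≠ 0 := by linarith
  field_simp

/-- Certificate A of the corner for `q ≥ 4k⁴` (non-negative coefficients in `r = q − 4k⁴`, `d = k − 3`). -/
lemma largeQ_certA (K q r d : ℚ) (hK : K = d + 3) (hq : q = 4 * K ^ 4 + r) (hr : 0 ≤ r) (hd : 0 ≤ d) :
    0 ≤ (2 * K - 1) * q * (q + 1 - (K - 1) ^ 2) - (K - 1) * (q + 1) * (2 * q - K + 2) := by
  subst hq; subst hK
  have : (2 * (d + 3) - 1) * (4 * (d + 3) ^ 4 + r) * (4 * (d + 3) ^ 4 + r + 1 - (d + 3 - 1) ^ 2)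
      - (d + 3 - 1) * (4 * (d + 3) ^ 4 + r + 1) * (2 * (4 * (d + 3) ^ 4 + r) - (d + 3) + 2) = (r * (r * (1 : ℚ) + (d * (d * (d * (d * (8 : ℚ) + (94 : ℚ)) + (420 : ℚ)) + (839 : ℚ)) + (631 : ℚ))) + (d * (d * (d * (d * (d * (d * (d * (d * (16 : ℚ) + (376 : ℚ)) + (3888 : ℚ)) + (23084 : ℚ)) + (85996 : ℚ)) + (205680 : ℚ)) + (308233 : ℚ)) + (264495 : ℚ)) + (99470 : ℚ))) := by ring
  rw [this]; positivity

/-- Certificate B of the corner for `q ≥ 4k⁴` (non-negative coefficients in `r = q − 4k⁴`, `d = k − 3`). -/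
lemma largeQ_certB (K q r d : ℚ) (hK : K = d + 3) (hq : q = 4 * K ^ 4 + r) (hr : 0 ≤ r) (hd : 0 ≤ d) :
    0 ≤ ((2 * K - 1) * q * (q + 1 - (K - 1) ^ 2) - (K - 1) * (q + 1) * (2 * q - K + 2)) ^ 2
      - (2 * K - 1) ^ 2 * (K - 2) ^ 2 * (q + 1) * (q + 1 - (K - 1) ^ 2) ^ 2 := by
  subst hq; subst hK
  have : ((2 * (d + 3) - 1) * (4 * (d + 3) ^ 4 + r) * (4 * (d + 3) ^ 4 + r + 1 - (d + 3 - 1) ^ 2)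
      - (d + 3 - 1) * (4 * (d + 3) ^ 4 + r + 1) * (2 * (4 * (d + 3) ^ 4 + r) - (d + 3) + 2)) ^ 2
      - (2 * (d + 3) - 1) ^ 2 * (d + 3 - 2) ^ 2 * (4 * (d + 3) ^ 4 + r + 1) * (4 * (d + 3) ^ 4 + r + 1 - (d + 3 - 1) ^ 2) ^ 2
      = (r * (r * (r * (r * (1 : ℚ) + (d * (d * (d * (d * (12 : ℚ) + (160 : ℚ)) + (771 : ℚ)) + (1608 : ℚ)) + (1237 : ℚ))) + (d * (d * (d * (d * (d * (d * (d * (d * (48 : ℚ) + (1344 : ℚ)) + (15888 : ℚ)) + (104536 : ℚ)) + (421334 : ℚ)) + (1069980 : ℚ)) + (1677394 : ℚ)) + (1487918 : ℚ)) + (572926 : ℚ))) + (d * (d * (d * (d * (d * (d * (d * (d * (d * (d * (d * (d * (64 : ℚ) + (3072 : ℚ)) + (62448 : ℚ)) + (732608 : ℚ)) + (5610492 : ℚ)) + (29818980 : ℚ)) + (113441179 : ℚ)) + (312497294 : ℚ)) + (620414851 : ℚ)) + (867591706 : ℚ)) + (812502677 : ℚ)) + (458126980 : ℚ)) + (117738865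 : ℚ))) + (d * (d * (d * (d * (d * (d * (d * (d * (d * (d * (d * (d * (d * (d * (d * (1024 : ℚ) + (44928 : ℚ)) + (918400 : ℚ)) + (11604944 : ℚ)) + (101391120 : ℚ)) + (648892332 : ℚ)) + (3143027208 : ℚ)) + (11734196288 : ℚ)) + (34048725676 : ℚ)) + (76796142731 : ℚ)) + (133553178050 : ℚ)) + (175880385806 : ℚ)) + (169802102382 : ℚ)) + (113465803830 : ℚ)) + (46929054750 : ℚ)) + (9057072775 : ℚ))) := by ring
  rw [this]; positivity

/-- **THE CORNER FOR `q ≥ 4k⁴`, UNIFORMLY IN `k`**: for `3 ≤ k` and `4k⁴ ≤ q`, `Φ(q+k, q) ≤ R̂(q, k, q+1−k)`. -/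
theorem rhat_corner_of_large_q (q k : ℕ) (hk : 3 ≤ k) (hq : 4 * k ^ 4 ≤ q) :
    phiK (q + k) q ≤ rhat q k (q + 1 - k) := by
  have hk4 : k ^ 2 ≤ k ^ 4 := Nat.pow_le_pow_right (by omega) (by norm_num)
  have hkq : k + 1 ≤ q := by nlinarith [hk4]
  set m := q + 1 - k with hm
  have hmk : m + k = q + 1 := by omega
  have hqm : q - m = k - 1 := by omega
  -- the first column
  have hR : rhat q k m = ∑ i ∈ Ioo 0 k, ((q + k - m).choose i : ℚ) * sumW q m i := rhat_eq_sumW q k m (by omega)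
  have hn : q + k - m = 2 * k - 1 := by omega
  have hcol : ((2 * k - 1).choose 1 : ℚ) * sumW q m 1 ≤ ∑ i ∈ Ioo 0 k, ((q + k - m).choose i : ℚ) * sumW q m i := by
    rw [hn]
    apply Finset.single_le_sum (f := fun i => ((2 * k - 1).choose i : ℚ) * sumW q m i)
    · intro i _; have := sumW_pos q m i; positivity
    · rw [Finset.mem_Ioo]; omega
  rw [Nat.choose_one_right] at hcol
  -- the anchor at the corner
  have hanc := sumW_one_anchor q m
  have hm' : (m : ℚ) = (q : ℚ) + 1 - k := by
    rw [hm, Nat.cast_sub (by omega)]; push_cast; ring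
  rw [hm'] at hanc
  -- S² ≤ q
  have hS2 : (sumS q m) ^ 2 ≤ (q : ℚ) := by rw [hm]; exact sumS_corner_sq_le q k (by omega) (by omega)
  have hS0 : 0 < sumS q m := sumS_pos q m
  -- Φ's bound
  have hkr : ((k : ℚ) - 1) ^ 2 < (q : ℚ) + 1 := by
    have h1 : ((k : ℚ) - 1) ^ 2 ≤ (k : ℚ) ^ 2 := by nlinarith [(show (3 : ℚ) ≤ k by exact_mod_cast hk)]
    have h2 : ((k : ℚ) ^ 2) ≤ (k : ℚ) ^ 4 := by exact_mod_cast hk4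
    have h3 : 4 * (k : ℚ) ^ 4 ≤ q := by exact_mod_cast hq
    nlinarith
  have hPhi := phiK_le_of_sq_lt q k (by omega) hkr
  -- the certificates
  obtain ⟨d, rfl⟩ : ∃ d, k = d + 3 := ⟨k - 3, by omega⟩
  obtain ⟨r, hr⟩ : ∃ r, q = 4 * (d + 3) ^ 4 + r := ⟨q - 4 * (d + 3) ^ 4, by omega⟩
  obtain ⟨K, hK⟩ : ∃ K : ℚ, K = (d : ℚ) + 3 := ⟨_, rfl⟩
  have hKc : ((d + 3 : ℕ) : ℚ) = K := by rw [hK]; push_cast; ring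
  have hqr : (q : ℚ) = 4 * K ^ 4 + r := by rw [hr, hK]; push_cast; ring
  have hA := largeQ_certA K q r d hK hqr (by positivity) (by positivity)
  have hB := largeQ_certB K q r d hK hqr (by positivity) (by positivity)
  rw [hKc] at hPhi hanc hkr
  obtain ⟨Qd, hQd⟩ : ∃ Qd : ℚ, Qd = (q : ℚ) + 1 - (K - 1) ^ 2 := ⟨_, rfl⟩
  rw [← hQd] at hA hB hPhi
  have hQpos : 0 < Qd := by rw [hQd]; linarith
  have hK3 : (3 : ℚ) ≤ K := by rw [hK]; linarith [(Nat.cast_nonneg d : (0 : ℚ) ≤ d)]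
  obtain ⟨L, hL⟩ : ∃ L : ℚ, L = (2 * K - 1) * q - (K - 1) * ((q : ℚ) + 1) / Qd * (2 * q - K + 2) := ⟨_, rfl⟩
  have hLQ : L * Qd = (2 * K - 1) * q * Qd - (K - 1) * ((q : ℚ) + 1) * (2 * q - K + 2) := by
    rw [hL]; field_simp
  have hLQ0 : 0 ≤ L * Qd := by rw [hLQ]; exact hA
  have hL0 : 0 ≤ L := nonneg_of_mul_nonneg_left hLQ0 hQpos
  have hK2 : 0 ≤ (2 * K - 1) * (K - 2) := by nlinarith
  have hsq : ((2 * K - 1) * (K - 2) * Qd * sumS q m) ^ 2 ≤ (L * Qd) ^ 2 := by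
    rw [hLQ]
    have e : ((2 * K - 1) * (K - 2) * Qd * sumS q m) ^ 2
        = (2 * K - 1) ^ 2 * (K - 2) ^ 2 * Qd ^ 2 * (sumS q m) ^ 2 := by ring
    rw [e]
    have h1 : (2 * K - 1) ^ 2 * (K - 2) ^ 2 * Qd ^ 2 * (sumS q m) ^ 2
        ≤ (2 * K - 1) ^ 2 * (K - 2) ^ 2 * Qd ^ 2 * ((q : ℚ) + 1) := by
      apply mul_le_mul_of_nonneg_left (by linarith) (by positivity)
    have h2 : (2 * K - 1) ^ 2 * (K - 2) ^ 2 * Qd ^ 2 * ((q : ℚ) + 1)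
        ≤ ((2 * K - 1) * q * Qd - (K - 1) * ((q : ℚ) + 1) * (2 * q - K + 2)) ^ 2 := by
      linarith [hB]
    exact le_trans h1 h2
  have hlin : (2 * K - 1) * (K - 2) * Qd * sumS q m ≤ L * Qd := by
    have h1 : 0 ≤ (2 * K - 1) * (K - 2) * Qd * sumS q m := by positivity
    exact (pow_le_pow_iff_left₀ h1 hLQ0 two_ne_zero).mp hsq
  have hlin' : (2 * K - 1) * (K - 2) * sumS q m ≤ L := by
    have := hlin
    rw [show (2 * K - 1) * (K - 2) * Qd * sumS q m = Qd * ((2 * K - 1) * (K - 2) * sumS q m) by ring,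
      mul_comm L Qd] at this
    exact le_of_mul_le_mul_left this hQpos
  -- conclude: (2K-1) W_1 ≥ Φ
  have hW1 : (2 * K - 1) * sumW q m 1 ≥ phiK (q + (d + 3)) q := by
    have hden : (0 : ℚ) < (q : ℚ) + ((q : ℚ) + 1 - K) + 1 := by rw [hK]; linarith
    have hW : sumW q m 1 = ((q : ℚ) - ((q : ℚ) - ((q : ℚ) + 1 - K) - 1) * sumS q m) / ((q : ℚ) + ((q : ℚ) + 1 - K) + 1) := by
      rw [eq_div_iff hden.ne']; linarith
    rw [hW, ge_iff_le, ← mul_div_assoc, le_div_iff₀ hden]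
    have e1 : (q : ℚ) - ((q : ℚ) - ((q : ℚ) + 1 - K) - 1) * sumS q m = q - (K - 2) * sumS q m := by ring
    have e2 : (q : ℚ) + ((q : ℚ) + 1 - K) + 1 = 2 * q - K + 2 := by ring
    rw [e1, e2]
    have hPhi' : phiK (q + (d + 3)) q * (2 * q - K + 2) ≤ (K - 1) * ((q : ℚ) + 1) / Qd * (2 * q - K + 2) := by
      apply mul_le_mul_of_nonneg_right hPhi; rw [hK]; linarith
    calc phiK (q + (d + 3)) q * (2 * q - K + 2) ≤ (K - 1) * ((q : ℚ) + 1) / Qd * (2 * q - K + 2) := hPhi'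
      _ = (2 * K - 1) * q - L := by rw [hL]; ring
      _ ≤ (2 * K - 1) * q - (2 * K - 1) * (K - 2) * sumS q m := by linarith
      _ = (2 * K - 1) * (q - (K - 2) * sumS q m) := by ring
  rw [hR]
  calc phiK (q + (d + 3)) q ≤ (2 * K - 1) * sumW q m 1 := hW1
    _ = ((2 * (d + 3) - 1 : ℕ) : ℚ) * sumW q m 1 := by
        rw [hK]; push_cast [Nat.cast_sub (by omega : 1 ≤ 2 * (d + 3))]; ring
    _ ≤ _ := hcol

end PercRepro
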